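import Summits.QuantumFields.YangMills.Theorems.LuscherReductionRunningReductionInnerCopiesForm
import Summits.QuantumFields.YangMills.Theorems.LuscherReductionTwistedTraceScalingBTTauBudget
import HarnessLib

/-!
# The cross bound in closed form and at the logarithmic separation: `crossBound L β m = e^{6L³β}·e^{−βm²/(6L³)}`, `crossBound 1 B √(6κ log B/B) = e^{6B}·B^{−κ}` — the numerology
# half (K-far-4) of the far-pair kernel estimate of hT at rate
# (route `FlatTubeReduction`, crux K1 `NearFlatRatioLaw` stmt-QuantumFields-24720; seat `ym-line-ftr-p1` g14; rate twin «ratepack-v3 / frozen fibres»; R2b1 RECORD rung — no summit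
# statement is proved here)

WHY (memo `Cruxes/NearFlatRatioLaw/Lines/ratepack-v3-frozen-g12.md` §8.4).  `…FarPairKernels` bounds both kernels on far slow pairs by RED's `crossBound` of the separation; to compare with
the one-site top value `λ₀(L³β) ≍ e^{6L³β}(L³β)^{-9/2}` (lane A's `BTTopValue` floor) one needs the bound in closed form and its value at the separation `m = √(6κ·log B/B)`, where the
Gaussian factor is exactly `B^{−κ}`: far pairs at `κ > 9/2 + 2/3·(…)` are `O(λ_b²)`-negligible against `λ₀`.
* `crossBound_eq` — `crossBound L β m = exp(6L³β)·exp(−βm²/(6L³))` (`|Edge 3 L| = 3L³`, lane A's `card_edge_three`);  `crossBound_one_eq` — `crossBound 1 B m = exp(6B)·exp(−Bm²/6)`;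
* ★ `crossBound_one_at_log` — for `B ≥ 1`, `κ ≥ 0`: `crossBound 1 B √(6κ log B/B) = exp(6B)·B^{−κ}`;  `crossBound_mono` — `crossBound` is antitone in `m ≥ 0` (`β ≥ 0`).
HONEST FRAMING: real-analysis numerology; femto rung R2b1 (RECORD label); not infinite volume, not a gap, not Clay.  No defs, no named facts, no `sorry`.
-/

set_option autoImplicit false

noncomputable section

open Real
open Literature.MathematicalPhysics.QuantumFieldTheory
open Literature.MathematicalPhysics.QuantumLattice

namespace Summit.QuantumFields.YangMills.Theorems.FemtoTransferGap.TwoLattice.ConstTube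

open Summit.QuantumFields.YangMills.Theorems.FemtoTransferGap

variable {L : ℕ} [NeZero L]

/-- **Closed form**: `crossBound L β m = exp(6L³β)·exp(−βm²/(6L³))`. [folklore] -/
theorem crossBound_eq (β m : ℝ) : crossBound L β m = Real.exp (6 * (L : ℝ) ^ 3 * β) * Real.exp (-(β * m ^ 2 / (6 * (L : ℝ) ^ 3))) := by
  have hL0 : (0 : ℝ) < L := by exact_mod_cast Nat.pos_of_ne_zero (NeZero.ne L)
  have hL : (0 : ℝ) < (L : ℝ) ^ 3 := by positivity
  unfold crossBound
  rw [← Real.exp_nat_mul, card_edge_three]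
  rw [show (3 * (L : ℝ) ^ 3) * (2 * β) = 6 * (L : ℝ) ^ 3 * β by ring,
    show β / 2 * (m ^ 2 / (3 * (L : ℝ) ^ 3)) = β * m ^ 2 / (6 * (L : ℝ) ^ 3) by field_simp; ring]

/-- One site: `crossBound 1 B m = exp(6B)·exp(−Bm²/6)`. [folklore] -/
theorem crossBound_one_eq (B m : ℝ) : crossBound 1 B m = Real.exp (6 * B) * Real.exp (-(B * m ^ 2 / 6)) := by
  rw [crossBound_eq]; norm_num

/-- ★ **At the logarithmic separation** `m = √(6κ·log B / B)` (`B ≥ 1`, `κ ≥ 0`): `crossBound 1 B m = exp(6B)·B^{−κ}`. [folklore] -/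
theorem crossBound_one_at_log {B κ : ℝ} (hB : 1 ≤ B) (hκ : 0 ≤ κ) :
    crossBound 1 B (Real.sqrt (6 * κ * Real.log B / B)) = Real.exp (6 * B) * B ^ (-κ) := by
  have hB0 : 0 < B := by linarith
  have hlog : 0 ≤ Real.log B := Real.log_nonneg hB
  rw [crossBound_one_eq, Real.sq_sqrt (by positivity), Real.rpow_def_of_pos hB0]
  have e1 : B * (6 * κ * Real.log B / B) = 6 * κ * Real.log B := by
    rw [mul_div_assoc', mul_comm B, mul_div_assoc, div_self hB0.ne', mul_one]
  rw [e1, show -(6 * κ * Real.log B / 6) = Real.log B * -κ by ring]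

/-- `crossBound` is antitone in the separation on `m ≥ 0` (`β ≥ 0`). [folklore] -/
theorem crossBound_mono {β : ℝ} (hβ : 0 ≤ β) {m m' : ℝ} (hm : 0 ≤ m) (hmm : m ≤ m') : crossBound L β m' ≤ crossBound L β m := by
  rw [crossBound_eq, crossBound_eq]
  refine mul_le_mul_of_nonneg_left (Real.exp_le_exp.mpr ?_) (Real.exp_pos _).le
  have hL0 : (0 : ℝ) < L := by exact_mod_cast Nat.pos_of_ne_zero (NeZero.ne L)
  have hL : (0 : ℝ) < 6 * (L : ℝ) ^ 3 := by positivity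
  have h2 : m ^ 2 ≤ m' ^ 2 := pow_le_pow_left₀ hm hmm 2
  have := div_le_div_of_nonneg_right (mul_le_mul_of_nonneg_left h2 hβ) hL.le
  linarith

end Summit.QuantumFields.YangMills.Theorems.FemtoTransferGap.TwoLattice.ConstTube

end
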